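import Mathlib
import HarnessLib
import Summits.HubbardSuperconductivity.HubbardSuperconductivity.Theorems.KLProgrammeSoftPartnerDependentBand
import Summits.HubbardSuperconductivity.HubbardSuperconductivity.Theorems.KLProgrammeForwardBubbleSoftPartner

/-!
# Route `KLProgramme` — crux K3, ENGINE child gen 6 (stmt-HubbardSuperconductivity-20236 `KLRegimeEngineV16`), stub `stub_engine_step_values`,
# (E2-v10) ph-loop inputs: the FORWARD regime with a LOCALISED vertex — flat part by the zero-sound structure, frequency-dependent remainder sign-blind
# (cell gate-hubbard-kl, seat hubbard-kl-k3c2-p2 g7)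

WHY.  At the middle scales `12 < n < n_β − T` the forward particle–hole loop (`|q₀|, δ_max ≤ Λ_n/8`) is booked under the below-resolution `phGain` only
through the zero-sound cancellation, which needs an `e`-FLAT vertex weight `A` (radially Lipschitz, loop-frequency independent:
`klfp_planar_bubble_norm_le_soft`, p487588).  The actual vertex product `K(x,z)K(z,y)` depends on the loop frequency and momentum; the taker localises it
as `A + R_i` with a flat part `A` and a remainder `R_i` of sup `ε` (small by the history's first moments / value increments).  This file books the
two parts in ONE citation: **`klhp_planar_soft_split_norm_le`** —
`‖β⁻¹ • Σ_i ∫ d²p (A + R_i)(p)·Φ_f(ω_i,e(p))·Φ_d(ω_i + 2πm₀/β, e′(p))‖ ≤ [ZS bracket of `klfp_planar_bubble_norm_le_soft` for A] + 2π·(512/π)·M_f·(ε·π√2/(Dt_min−κ₁))·M′`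
(the remainder by `klhd_planar_soft_signblind_norm_le`, β-uniform).  Hypotheses = the union of the two lemmas' (soft partner `d`: Lipschitz `≤ ℓ′/Λ_n²`,
`‖d‖ ≤ M′`, `d = 0` for `s ≥ (4Λ_n)²`; product weight `f·d`; transfer `q₀ = 2πm₀/β` with `|q₀| ≤ Λ_n/8`; ray shift `½`-Lipschitz on the window).

Pure analysis; nothing about the model's effective action is asserted; nothing asserts superconductivity.
-/

noncomputable section

namespace Summit.HubbardSuperconductivity.HubbardSuperconductivity.Theorems.KLRegimeSplit

set_option linter.dupNamespace false -- summit = problem name (single-conjunct summit), D-0017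

open Real Set Filter MeasureTheory Complex Literature.MathematicalPhysics.QuantumLattice Literature.Probability.LatticeModels
open Literature.MathematicalPhysics.QuantumLattice.BandSectorCounting
open Summit.HubbardSuperconductivity.HubbardSuperconductivity.Theorems.PerturbedFermiCurve
open Summit.HubbardSuperconductivity.HubbardSuperconductivity.Theorems.KLProgrammeLegKernels

section Frame

variable {a b : ℝ} (B : BandBounds a b) {δ : (Fin 2 → ℝ) → ℝ} (hδ1 : ContDiff ℝ 1 δ) {κ₀ κ₁ : ℝ}
  (hδ : ∀ k : Fin 2 → ℝ, (∀ i, |k i| ≤ π) → |δ k| ≤ κ₀)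
  (hκ : ∀ k : Fin 2 → ℝ, (∀ i, |k i| ≤ π) → ‖fderiv ℝ δ k‖ ≤ κ₁) (hκ₁ : κ₁ < B.Dtmin)

omit B in
/-- The planar integrand is additive in the vertex weight. -/
theorem klhp_integrand_add (δ : (Fin 2 → ℝ) → ℝ) (μ : ℝ) (A R : ℝ × ℝ → ℂ) (f d : ℝ → ℂ) (e' : ℝ × ℝ → ℝ) (k₀ q₀ : ℝ) (p : ℝ × ℝ) :
    klfb_integrand δ μ (fun p => A p + R p) f d e' k₀ q₀ p = klfb_integrand δ μ A f d e' k₀ q₀ p + klfb_integrand δ μ R f d e' k₀ q₀ p := by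
  unfold klfb_integrand; ring

include B hδ1 hδ hκ hκ₁ in
/-- **THE FORWARD LOOP WITH A LOCALISED VERTEX: flat part by zero sound, remainder sign-blind.**  Flat weight `A` (continuous, supported in the open
square, `‖A‖ ≤ A₀`, radially `A₁`-Lipschitz); remainders `R_i` (continuous, supported in the open square, `‖R_i‖ ≤ ε`); slice weight `f`, soft weight `d`
and product `f·d` as in `klfp_planar_bubble_norm_le_soft`; shifted band `e′` with `|e′ − e| ≤ δ_max ≤ Λ_n/8` on the open square and ray shift `½`-Lipschitz on
`[−4Λ_n, 4Λ_n]`; transfer `q₀ = 2πm₀/β` with `|q₀| ≤ Λ_n/8`; `β ≥ klBetaMin`, `n ≤ n_β+1`, `M ≥ β·4Λ_n/(2π) + 1`.  Then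
`‖β⁻¹ • Σ_i ∫ d²p (A + R_i)(p)Φ_f(ω_i,e(p))Φ_d(ω_i + q₀, e′(p))‖ ≤ ZS(A) + 2π·(512/π)·M_f·(ε·π√2/(Dt_min − κ₁))·M′`. -/
theorem klhp_planar_soft_split_norm_le {M : ℕ} {A : ℝ × ℝ → ℂ} (hA : Continuous A)
    (hAsupp : ∀ p : ℝ × ℝ, A p ≠ 0 → |p.1| < π ∧ |p.2| < π) {A₀ A₁ : ℝ} (hA0 : ∀ p, ‖A p‖ ≤ A₀)
    (hA1 : ∀ θ t t' : ℝ, 0 ≤ t → 0 ≤ t' →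
      ‖A (t * Real.cos θ, t * Real.sin θ) - A (t' * Real.cos θ, t' * Real.sin θ)‖ ≤ A₁ * |t - t'|)
    {R : MatsubaraIdx M → ℝ × ℝ → ℂ} (hR : ∀ i, Continuous (R i)) (hRsupp : ∀ i, ∀ p : ℝ × ℝ, R i p ≠ 0 → |p.1| < π ∧ |p.2| < π)
    {ε : ℝ} (hε : 0 ≤ ε) (hRε : ∀ i p, ‖R i p‖ ≤ ε)
    {κ₂ : ℝ} (hκ₂ : 0 ≤ κ₂)
    (hD2 : ∀ θ s t : ℝ, s ∈ Icc 0 (π / ‖dir θ‖) → t ∈ Icc 0 (π / ‖dir θ‖) →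
      |fderiv ℝ δ (s • dir θ) (dir θ) - fderiv ℝ δ (t • dir θ) (dir θ)| ≤ κ₂ * |s - t|)
    {f d : ℝ → ℂ} {Lf Mf Ld M' ℓ' LF MF ℓ : ℝ} {n : ℕ}
    (hlip : ∀ s s', ‖f s - f s'‖ ≤ Lf * |s - s'|) (hbd : ∀ s, ‖f s‖ ≤ Mf)
    (hin : ∀ s, s ≤ (klScale klE0 n / 2) ^ 2 → f s = 0) (hout : ∀ s, (4 * klScale klE0 n) ^ 2 ≤ s → f s = 0)
    (hdlip : ∀ s s', ‖d s - d s'‖ ≤ Ld * |s - s'|) (hdbd : ∀ s, ‖d s‖ ≤ M') (hLd : Ld ≤ ℓ' / klScale klE0 n ^ 2)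
    (hdout : ∀ s, (4 * klScale klE0 n) ^ 2 ≤ s → d s = 0)
    (hMF : 0 ≤ MF) (hFlip : ∀ s s', ‖f s * d s - f s' * d s'‖ ≤ LF * |s - s'|) (hFbd : ∀ s, ‖f s * d s‖ ≤ MF)
    (hLF : LF ≤ ℓ / klScale klE0 n ^ 2)
    {e' : ℝ × ℝ → ℝ} (he' : Continuous e') {μ δmax : ℝ} (hδ0 : 0 ≤ δmax) (hδmax : δmax ≤ klScale klE0 n / 8)
    (he'δ : ∀ p : ℝ × ℝ, |p.1| < π → |p.2| < π → |e' p - klfb_band δ μ p| ≤ δmax)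
    (hσ : ∀ θ : ℝ, ∀ e ∈ Icc (-(4 * klScale klE0 n)) (4 * klScale klE0 n), ∀ e'' ∈ Icc (-(4 * klScale klE0 n)) (4 * klScale klE0 n),
      |klfb_shift δ μ e' θ e - klfb_shift δ μ e' θ e''| ≤ |e - e''| / 2)
    (hlo : a < μ - 4 * klScale klE0 n - κ₀) (hhi : μ + 4 * klScale klE0 n + κ₀ < b)
    {β : ℝ} (hβ : klBetaMin ≤ β) (hn : n ≤ nScales β + 1) (m₀ : ℤ) (hq₀ : |2 * Real.pi * (m₀ : ℝ) / β| ≤ klScale klE0 n / 8)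
    (hM : β * (4 * klScale klE0 n) / (2 * Real.pi) + 1 ≤ M) :
    ‖β⁻¹ • ∑ i : MatsubaraIdx M, ∫ p : ℝ × ℝ,
        klfb_integrand δ μ (fun p => A p + R i p) f d e' (matsubaraFreq β M i) (2 * Real.pi * (m₀ : ℝ) / β) p‖ ≤
      2 * Real.pi *
          (524288 / Real.pi * (ℓ + 8 * MF) *
              (Real.pi * Real.sqrt 2 / (B.Dtmin - κ₁) * A₁ / (B.Dtmin - κ₁) +
                A₀ * (1 / (B.Dtmin - κ₁) ^ 2 + Real.pi * Real.sqrt 2 * (2 + κ₂) / (B.Dtmin - κ₁) ^ 3)) * klScale klE0 n +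
            393216 / Real.pi * (ℓ + 8 * MF) * (A₀ * (Real.pi * Real.sqrt 2 / (B.Dtmin - κ₁))) * ((Real.pi / β) / klScale klE0 n) +
              256 / Real.pi * Mf * (A₀ * (Real.pi * Real.sqrt 2 / (B.Dtmin - κ₁))) *
                ((65 * ℓ' + 17408 / 3 * M') / klScale klE0 n ^ 2 * klScale klE0 n) * (|2 * Real.pi * (m₀ : ℝ) / β| + δmax)) +
        2 * Real.pi * (512 / Real.pi * Mf * (ε * (Real.pi * Real.sqrt 2 / (B.Dtmin - κ₁)) * M')) := by
  have hδc : Continuous δ := hδ1.continuous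
  have hΛ := klth_klScale_pos n
  have hβ0 : 0 < β := pos_of_klBetaMin_le hβ
  have hr₁ : 0 < klScale klE0 n / 2 := by positivity
  have hr : 0 < 4 * klScale klE0 n := by positivity
  set q₀ : ℝ := 2 * Real.pi * (m₀ : ℝ) / β with hq₀def
  -- the two planar bounds
  have hZS := klfp_planar_bubble_norm_le_soft B hδ1 hδ hκ hκ₁ hA hAsupp hA0 hA1 hκ₂ hD2 hlip hbd hin hout hdlip hdbd hLd hdout hMF hFlip hFbd hLF
    he' hδ0 hδmax he'δ hlo hhi hq₀ hβ hn hM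
  have hSB := klhd_planar_soft_signblind_norm_le B hδ1 hδ hκ hκ₁ (A := R) hR hRsupp hε hRε hlip hbd hin hout hdlip hdbd
    (e' := fun _ => e') (fun _ => he') (fun θ _ => hσ θ) hlo hhi hβ hn m₀
  -- integrability of both families (continuous, compactly supported; the partner frequency is fermionic)
  have hν0 : ∀ i : MatsubaraIdx M, matsubaraFreq β M i + q₀ ≠ 0 := by
    intro i
    rw [klhp_matsubaraFreq_add_bosonic β M i m₀]
    have hodd : (2 * ((matsubaraInt M i + m₀ : ℤ) : ℝ) + 1) ≠ 0 := by
      have h : (2 * (matsubaraInt M i + m₀) + 1 : ℤ) ≠ 0 := by omega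
      exact_mod_cast h
    exact div_ne_zero (mul_ne_zero Real.pi_pos.ne' hodd) hβ0.ne'
  have hintA : ∀ i : MatsubaraIdx M, Integrable (klfb_integrand δ μ A f d e' (matsubaraFreq β M i) q₀) := by
    intro i
    refine (klhp_continuous_integrand hδc hA hlip hbd hin hout hr₁ hr hdlip he' μ (hν0 i)).integrable_of_hasCompactSupport ?_
    unfold klfb_integrand
    exact ((klfb_hasCompactSupport_of_square hAsupp).mul_right).mul_right
  have hintR : ∀ i : MatsubaraIdx M, Integrable (klfb_integrand δ μ (R i) f d e' (matsubaraFreq β M i) q₀) := by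
    intro i
    refine (klhp_continuous_integrand hδc (hR i) hlip hbd hin hout hr₁ hr hdlip he' μ (hν0 i)).integrable_of_hasCompactSupport ?_
    unfold klfb_integrand
    exact ((klfb_hasCompactSupport_of_square (hRsupp i)).mul_right).mul_right
  -- split
  rw [← hq₀def] at hSB
  have hsplit : (β⁻¹ • ∑ i : MatsubaraIdx M, ∫ p : ℝ × ℝ, klfb_integrand δ μ (fun p => A p + R i p) f d e' (matsubaraFreq β M i) q₀ p) =
      (β⁻¹ • ∑ i : MatsubaraIdx M, ∫ p : ℝ × ℝ, klfb_integrand δ μ A f d e' (matsubaraFreq β M i) q₀ p) +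
        (β⁻¹ • ∑ i : MatsubaraIdx M, ∫ p : ℝ × ℝ, klfb_integrand δ μ (R i) f d e' (matsubaraFreq β M i) q₀ p) := by
    rw [← smul_add, ← Finset.sum_add_distrib]
    congr 1
    refine Finset.sum_congr rfl fun i _ => ?_
    rw [← integral_add (hintA i) (hintR i)]
    refine integral_congr_ae (Filter.Eventually.of_forall fun p => ?_)
    exact klhp_integrand_add δ μ A (R i) f d e' _ _ p
  rw [hsplit]
  exact (norm_add_le _ _).trans (add_le_add hZS hSB)

end Frame

end Summit.HubbardSuperconductivity.HubbardSuperconductivity.Theorems.KLRegimeSplit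

end
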